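import Mathlib
import HarnessLib
import Literature.MathematicalPhysics.QuantumLattice.HubbardGrandCanonicalDensity
import Summits.HubbardSuperconductivity.HubbardSuperconductivity.Theorems.WeakCouplingBCSWcbcsBcsConstructionEnergyDensityLimit

/-!
# WeakCouplingBCS / crux `WcbcsBcsConstruction` — the limiting grand-canonical equation of state of the
# 2D Hubbard torus: concavity, Lipschitz and interaction bounds, and the reduction of stub (D)
# (`stub_regularEquationOfState`, OPEN) to a finite-volume "no density jump" condition

Line `ladder-scale-certified-chain` of crux stmt-HubbardSuperconductivity-2010; helpers `--supports` the item, they do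
NOT close stub (D). Write `E_L(U,y) = E₀(hubbardTorusWith 2 (L+1) 1 U y)`, `V_L = (L+1)²`,
`n_L(U,y) = Re ω₀[hubbardTorusWith 2 (L+1) 1 U y](N)/V_L` (tracial ground-state density) and
`e(U,y) = lim_L E_L(U,y)/V_L` — the limit exists for all `U, y` (`stub_torusGcEnergyDensityLimit`, p76736) and is
written with `limUnder`, exactly as in stub (D).

* `wcbcs_differentiableAt_of_concaveOn_of_second_difference` (pure real analysis): a function concave on `ℝ` whose
  symmetric second differences at `x` satisfy `∀ ε > 0 ∃ h > 0, f(x+h) + f(x-h) - 2f(x) ≥ -εh` is differentiable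
  at `x` (one-sided derivatives of a concave function, `Mathlib.Analysis.Convex.Deriv`).
* `wcbcs_eos_concaveOn`, `wcbcs_eos_sub_mem_Icc`, `wcbcs_eos_sub_free_mem_Icc`: `e(U,·)` is concave on `ℝ`,
  non-increasing and `2`-Lipschitz (`0 ≤ e(U,μ) - e(U,μ') ≤ 2(μ' - μ)` for `μ ≤ μ'`), and `0 ≤ e(U,·) - e(0,·) ≤ U`
  for `U ≥ 0` (the finite-volume facts of `HubbardGrandCanonicalDensity` § Torus passed to the limit).
* `wcbcs_groundEnergy_second_difference_ge` (finite volume, any torus): the Griffiths sandwich twice gives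
  `E(ν+h) + E(ν-h) - 2E(ν) ≥ -h (N(ν+h) - N(ν-h))`.
* `wcbcs_eos_differentiableAt_of_noDensityJump`: if at `(U, ν)` the finite-volume density increments across
  `[ν-h, ν+h]` can be made `≤ ε` by taking `h` small, along infinitely many volumes, then `e(U,·)` is differentiable
  at `ν`; `wcbcs_tendsto_gcDensity_of_differentiableAt`: at such a point `n_L(U,ν) → -∂_ν e(U,ν)` (Griffiths);
  `wcbcs_noDensityJump_of_differentiableAt`: conversely differentiability at `ν` gives the no-jump condition at `ν`
  (even eventually in `L`), so the two are equivalent.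
* `stub_regularEquationOfStateOfNoDensityJump` (registered sub-goal): the registered stub (D), VERBATIM, from its
  finite-volume normal form — no density jump at any `ν` of the window `[-4/5, -7/20]` plus the two bracket
  inequalities on the finite-volume densities at the window's ends (`liminf_L n_L(U,-4/5) ≤ 1-b`,
  `1-a ≤ limsup_L n_L(U,-7/20)`).

Griffiths, J. Math. Phys. 5 (1964) 1215; Koma–Tasaki, J. Stat. Phys. 76 (1994) §1. No definition is introduced.
The physical content of (D) — that the weakly repulsive model has no first-order density jump in the window — is
NOT proved here (open).
-/

set_option linter.dupNamespace false

namespace Summit.HubbardSuperconductivity.HubbardSuperconductivity.Theorems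

open Literature.MathematicalPhysics.QuantumLattice Literature.Probability.LatticeModels Matrix Filter Set
open scoped Matrix.Norms.L2Operator ComplexOrder Topology

/-! ### Pure real analysis: differentiability points of a concave function -/

/-- **A concave function with small symmetric second differences at `x` is differentiable at `x`.** For `f`
concave on `ℝ`: if for every `ε > 0` some step `h > 0` has `-εh ≤ f(x+h) + f(x-h) - 2f(x)`, then `f` is
differentiable at `x` (the second difference at step `h` is at most `h(f'₊(x) - f'₋(x)) ≤ 0`, so the hypothesis
forces `f'₋(x) = f'₊(x)`; the converse is immediate from the derivative). [folklore] -/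
theorem wcbcs_differentiableAt_of_concaveOn_of_second_difference {f : ℝ → ℝ} (hf : ConcaveOn ℝ univ f) {x : ℝ}
    (h2 : ∀ ε > 0, ∃ h > 0, -(ε * h) ≤ f (x + h) + f (x - h) - 2 * f x) : DifferentiableAt ℝ f x := by
  have hg : ConvexOn ℝ univ (-f) := hf.neg
  have hx : x ∈ interior (univ : Set ℝ) := by simp
  have hR : HasDerivWithinAt (-f) (derivWithin (-f) (Ioi x) x) (Ioi x) x :=
    hg.hasDerivWithinAt_rightDeriv_of_mem_interior hx
  have hL : HasDerivWithinAt (-f) (derivWithin (-f) (Iio x) x) (Iio x) x :=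
    hg.hasDerivWithinAt_leftDeriv_of_mem_interior hx
  have hLR : derivWithin (-f) (Iio x) x ≤ derivWithin (-f) (Ioi x) x :=
    hg.leftDeriv_le_rightDeriv_of_mem_interior hx
  have hRL : derivWithin (-f) (Ioi x) x ≤ derivWithin (-f) (Iio x) x := by
    refine le_of_forall_pos_le_add fun ε hε => ?_
    obtain ⟨h, hh, hbound⟩ := h2 ε hε
    have h1 : derivWithin (-f) (Ioi x) x ≤ slope (-f) x (x + h) :=
      hg.rightDeriv_le_slope_of_mem_interior hx (mem_univ _) (by linarith)
    have h1' : slope (-f) (x - h) x ≤ derivWithin (-f) (Iio x) x :=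
      hg.slope_le_leftDeriv_of_mem_interior (mem_univ _) hx (by linarith)
    rw [slope_def_field, Pi.neg_apply, Pi.neg_apply, add_sub_cancel_left, le_div_iff₀ hh] at h1
    rw [slope_def_field, Pi.neg_apply, Pi.neg_apply, sub_sub_cancel, div_le_iff₀ hh] at h1'
    have key : (derivWithin (-f) (Ioi x) x - derivWithin (-f) (Iio x) x) * h ≤ ε * h := by nlinarith
    have := le_of_mul_le_mul_right key hh
    linarith
  have heq : derivWithin (-f) (Iio x) x = derivWithin (-f) (Ioi x) x := le_antisymm hLR hRL
  rw [heq, hasDerivWithinAt_Iio_iff_Iic] at hL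
  have hd : HasDerivAt (-f) (derivWithin (-f) (Ioi x) x) x := by
    rw [← hasDerivWithinAt_univ, ← Iic_union_Ioi (a := x)]
    exact hL.union hR
  have := hd.neg
  simp only [neg_neg] at this
  exact this.differentiableAt

/-- **Limits of a frequently-bounded sequence**: if `a → A` and `c ≤ a L` for infinitely many `L`, then `c ≤ A`.
[folklore] -/
theorem wcbcs_le_of_frequently_le_of_tendsto {a : ℕ → ℝ} {A c : ℝ} (ha : Tendsto a atTop (𝓝 A))
    (hc : ∃ᶠ L in atTop, c ≤ a L) : c ≤ A :=
  isClosed_Ici.mem_of_frequently_of_tendsto hc ha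

/-! ### The limiting equation of state `e(U,·)`: existence (p76736), concavity, Lipschitz, interaction bounds -/

/-- The thermodynamic limit of the torus ground-state energy density, in `limUnder` form: for every `U, y`,
`E_L(U,y)/V_L → e(U,y)` (`stub_torusGcEnergyDensityLimit`, p76736, read through `tendsto_nhds_limUnder`). [folklore] -/
theorem wcbcs_eos_tendsto (U y : ℝ) :
    Tendsto (fun L : ℕ => (hubbardTorusWith 2 (L + 1) 1 U y).groundEnergy / ((L + 1 : ℕ) : ℝ) ^ 2) atTop
      (𝓝 (limUnder atTop (fun L : ℕ => (hubbardTorusWith 2 (L + 1) 1 U y).groundEnergy /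
        ((L + 1 : ℕ) : ℝ) ^ 2))) :=
  tendsto_nhds_limUnder (stub_torusGcEnergyDensityLimit U y)

/-- **The limiting equation of state is concave in the chemical potential**: `y ↦ e(U,y)` is concave on `ℝ`
(pointwise limit of the concave finite-volume energies `concaveOn_groundEnergy_hubbardTorusWith`). [folklore] -/
theorem wcbcs_eos_concaveOn (U : ℝ) :
    ConcaveOn ℝ univ (fun y : ℝ => limUnder atTop (fun L : ℕ =>
      (hubbardTorusWith 2 (L + 1) 1 U y).groundEnergy / ((L + 1 : ℕ) : ℝ) ^ 2)) := by
  refine ⟨convex_univ, fun x _ y _ a b ha hb hab => ?_⟩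
  simp only [smul_eq_mul]
  refine le_of_tendsto_of_tendsto
    (((wcbcs_eos_tendsto U x).const_mul a).add ((wcbcs_eos_tendsto U y).const_mul b))
    (wcbcs_eos_tendsto U (a * x + b * y)) (Eventually.of_forall fun L => ?_)
  have hV : (0 : ℝ) < ((L + 1 : ℕ) : ℝ) ^ 2 := by positivity
  have h := (concaveOn_groundEnergy_hubbardTorusWith (L + 1) 1 U).2 (mem_univ x) (mem_univ y) ha hb hab
  simp only [smul_eq_mul] at h
  show a * ((hubbardTorusWith 2 (L + 1) 1 U x).groundEnergy / ((L + 1 : ℕ) : ℝ) ^ 2) +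
      b * ((hubbardTorusWith 2 (L + 1) 1 U y).groundEnergy / ((L + 1 : ℕ) : ℝ) ^ 2) ≤
    (hubbardTorusWith 2 (L + 1) 1 U (a * x + b * y)).groundEnergy / ((L + 1 : ℕ) : ℝ) ^ 2
  rw [mul_div_assoc', mul_div_assoc', ← add_div]
  exact div_le_div_of_nonneg_right h hV.le

/-- **The limiting equation of state is non-increasing and `2`-Lipschitz**: for `μ ≤ μ'`,
`0 ≤ e(U,μ) - e(U,μ') ≤ 2(μ' - μ)` (from `groundEnergy_torus_sub_mem_Icc_of_le`, `|Λ| = V_L`). [folklore] -/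
theorem wcbcs_eos_sub_mem_Icc (U : ℝ) {μ μ' : ℝ} (h : μ ≤ μ') :
    limUnder atTop (fun L : ℕ => (hubbardTorusWith 2 (L + 1) 1 U μ).groundEnergy / ((L + 1 : ℕ) : ℝ) ^ 2) -
        limUnder atTop (fun L : ℕ => (hubbardTorusWith 2 (L + 1) 1 U μ').groundEnergy / ((L + 1 : ℕ) : ℝ) ^ 2) ∈
      Icc (0 : ℝ) (2 * (μ' - μ)) := by
  refine isClosed_Icc.mem_of_tendsto ((wcbcs_eos_tendsto U μ).sub (wcbcs_eos_tendsto U μ'))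
    (Eventually.of_forall fun L => ?_)
  have hV : (0 : ℝ) < ((L + 1 : ℕ) : ℝ) ^ 2 := by positivity
  obtain ⟨h0, h1⟩ := groundEnergy_torus_sub_mem_Icc_of_le (L + 1) 1 U h
  rw [← sub_div]
  refine ⟨div_nonneg h0 hV.le, ?_⟩
  rw [div_le_iff₀ hV]
  linarith

/-- **The interacting and free limiting equations of state differ by at most `U`**: for `0 ≤ U`,
`0 ≤ e(U,μ) - e(0,μ) ≤ U` (from `groundEnergy_torus_sub_free_mem_Icc`). [folklore] -/
theorem wcbcs_eos_sub_free_mem_Icc {U : ℝ} (hU : 0 ≤ U) (μ : ℝ) :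
    limUnder atTop (fun L : ℕ => (hubbardTorusWith 2 (L + 1) 1 U μ).groundEnergy / ((L + 1 : ℕ) : ℝ) ^ 2) -
        limUnder atTop (fun L : ℕ => (hubbardTorusWith 2 (L + 1) 1 0 μ).groundEnergy / ((L + 1 : ℕ) : ℝ) ^ 2) ∈
      Icc (0 : ℝ) U := by
  refine isClosed_Icc.mem_of_tendsto ((wcbcs_eos_tendsto U μ).sub (wcbcs_eos_tendsto 0 μ))
    (Eventually.of_forall fun L => ?_)
  have hV : (0 : ℝ) < ((L + 1 : ℕ) : ℝ) ^ 2 := by positivity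
  obtain ⟨h0, h1⟩ := groundEnergy_torus_sub_free_mem_Icc (L + 1) 1 μ hU
  rw [← sub_div]
  exact ⟨div_nonneg h0 hV.le, (div_le_iff₀ hV).2 h1⟩

/-! ### No density jump at `ν` ⟹ differentiability of `e(U,·)` at `ν` ⟹ convergence of the density -/

/-- **Second differences of the ground energy against density increments** (any torus, finite volume): for
`h > 0`, `-h (Re ω_{ν+h}(N) - Re ω_{ν-h}(N)) ≤ E(ν+h) + E(ν-h) - 2E(ν)` — the Griffiths sandwich
`gcNumber_torus_mem_Icc_slope` at `ν + h` (lower half) and at `ν - h` (upper half). [cite: KomaTasaki1994, §1] -/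
theorem wcbcs_groundEnergy_second_difference_ge (L : ℕ) (t U ν : ℝ) {h : ℝ} (hh : 0 < h) :
    -(h * (((hubbardTorusWith 2 L t U (ν + h)).groundStateFunctional totalNumber).re -
        ((hubbardTorusWith 2 L t U (ν - h)).groundStateFunctional totalNumber).re)) ≤
      (hubbardTorusWith 2 L t U (ν + h)).groundEnergy + (hubbardTorusWith 2 L t U (ν - h)).groundEnergy -
        2 * (hubbardTorusWith 2 L t U ν).groundEnergy := by
  obtain ⟨h1, -⟩ := gcNumber_torus_mem_Icc_slope L t U (ν + h) hh
  obtain ⟨-, h2⟩ := gcNumber_torus_mem_Icc_slope L t U (ν - h) hh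
  rw [add_sub_cancel_right, div_le_iff₀ hh] at h1
  rw [sub_add_cancel, le_div_iff₀ hh] at h2
  nlinarith

/-- **No density jump at `ν` implies differentiability of the limiting equation of state at `ν`.** If for every
`ε > 0` there is a step `h > 0` such that, for infinitely many `L`, the finite-volume density increment across
`[ν - h, ν + h]` is at most `ε`, `n_L(U,ν+h) - n_L(U,ν-h) ≤ ε`, then `e(U,·)` is differentiable at `ν`
(`wcbcs_groundEnergy_second_difference_ge` per unit volume, passed to the limit, and
`wcbcs_differentiableAt_of_concaveOn_of_second_difference`). [cite: KomaTasaki1994, §1] -/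
theorem wcbcs_eos_differentiableAt_of_noDensityJump (U ν : ℝ)
    (hnj : ∀ ε > 0, ∃ h > 0, ∃ᶠ L : ℕ in atTop,
      ((hubbardTorusWith 2 (L + 1) 1 U (ν + h)).groundStateFunctional totalNumber).re / ((L + 1 : ℕ) : ℝ) ^ 2 -
        ((hubbardTorusWith 2 (L + 1) 1 U (ν - h)).groundStateFunctional totalNumber).re /
          ((L + 1 : ℕ) : ℝ) ^ 2 ≤ ε) :
    DifferentiableAt ℝ (fun y : ℝ => limUnder atTop (fun L : ℕ =>
      (hubbardTorusWith 2 (L + 1) 1 U y).groundEnergy / ((L + 1 : ℕ) : ℝ) ^ 2)) ν := by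
  refine wcbcs_differentiableAt_of_concaveOn_of_second_difference (wcbcs_eos_concaveOn U) fun ε hε => ?_
  obtain ⟨h, hh, hfreq⟩ := hnj ε hε
  refine ⟨h, hh, wcbcs_le_of_frequently_le_of_tendsto
    (((wcbcs_eos_tendsto U (ν + h)).add (wcbcs_eos_tendsto U (ν - h))).sub
      ((wcbcs_eos_tendsto U ν).const_mul 2)) (hfreq.mono fun L hL => ?_)⟩
  have hV : (0 : ℝ) < ((L + 1 : ℕ) : ℝ) ^ 2 := by positivity
  have key := wcbcs_groundEnergy_second_difference_ge (L + 1) 1 U ν hh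
  rw [← sub_div, div_le_iff₀ hV] at hL
  rw [mul_div_assoc', ← add_div, ← sub_div, le_div_iff₀ hV]
  nlinarith

/-- **Griffiths' lemma at a differentiability point of the limiting equation of state**: if `e(U,·)` is
differentiable at `ν`, the tracial ground-state density converges, `n_L(U,ν) → -∂_ν e(U,ν)`
(`tendsto_gcDensity_of_hasDerivAt` with the limit supplied by p76736). [cite: KomaTasaki1994, §1] -/
theorem wcbcs_tendsto_gcDensity_of_differentiableAt (U ν : ℝ)
    (hd : DifferentiableAt ℝ (fun y : ℝ => limUnder atTop (fun L : ℕ =>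
      (hubbardTorusWith 2 (L + 1) 1 U y).groundEnergy / ((L + 1 : ℕ) : ℝ) ^ 2)) ν) :
    Tendsto (fun L : ℕ => ((hubbardTorusWith 2 (L + 1) 1 U ν).groundStateFunctional
      totalNumber).re / ((L + 1 : ℕ) : ℝ) ^ 2) atTop
      (𝓝 (-deriv (fun y : ℝ => limUnder atTop (fun L : ℕ =>
        (hubbardTorusWith 2 (L + 1) 1 U y).groundEnergy / ((L + 1 : ℕ) : ℝ) ^ 2)) ν)) :=
  tendsto_gcDensity_of_hasDerivAt 1 U ν (Eventually.of_forall (wcbcs_eos_tendsto U)) hd.hasDerivAt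

/-- **Converse: differentiability of the limiting equation of state at `ν` forces the no-jump condition at `ν`**, even
eventually in `L`: if `e(U,·)` is differentiable at `ν` then `∀ ε > 0 ∃ h > 0 ∀ᶠ L, n_L(U,ν+h) - n_L(U,ν-h) ≤ ε`
(Griffiths sandwich at steps `h, 2h`: `n_L(ν+h) - n_L(ν-h) ≤ (E_L(ν+h) - E_L(ν+2h) - E_L(ν-2h) + E_L(ν-h))/(h V_L)`, whose
limit is `o(h)/h`). So clause (i) of `stub_regularEquationOfStateOfNoDensityJump` at `ν` is EQUIVALENT to
differentiability of `e(U,·)` at `ν`. [cite: KomaTasaki1994, §1] -/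
theorem wcbcs_noDensityJump_of_differentiableAt (U ν : ℝ)
    (hd : DifferentiableAt ℝ (fun y : ℝ => limUnder atTop (fun L : ℕ =>
      (hubbardTorusWith 2 (L + 1) 1 U y).groundEnergy / ((L + 1 : ℕ) : ℝ) ^ 2)) ν) :
    ∀ ε > 0, ∃ h > 0, ∀ᶠ L : ℕ in atTop,
      ((hubbardTorusWith 2 (L + 1) 1 U (ν + h)).groundStateFunctional totalNumber).re / ((L + 1 : ℕ) : ℝ) ^ 2 -
        ((hubbardTorusWith 2 (L + 1) 1 U (ν - h)).groundStateFunctional totalNumber).re /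
          ((L + 1 : ℕ) : ℝ) ^ 2 ≤ ε := by
  intro ε hε
  set f : ℝ → ℝ := fun y : ℝ => limUnder atTop (fun L : ℕ =>
    (hubbardTorusWith 2 (L + 1) 1 U y).groundEnergy / ((L + 1 : ℕ) : ℝ) ^ 2) with hf
  -- the first-order Taylor estimate of `f` at `ν` with constant `ε/16` on a ball of radius `r`
  have hTaylor := (Asymptotics.isLittleO_iff.1 (hasDerivAt_iff_isLittleO.1 hd.hasDerivAt))
    (show (0:ℝ) < ε / 16 by positivity)
  obtain ⟨r, hr, hball⟩ := Metric.eventually_nhds_iff.1 hTaylor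
  have hT : ∀ y : ℝ, |y - ν| < r → |f y - f ν - (y - ν) * deriv f ν| ≤ ε / 16 * |y - ν| := fun y hy => by
    have := hball (by rwa [Real.dist_eq])
    simpa only [Real.norm_eq_abs, smul_eq_mul] using this
  refine ⟨r / 3, by positivity, ?_⟩
  set h := r / 3 with hh_def
  have hh : 0 < h := by positivity
  -- the four Taylor facts at `ν ± h`, `ν ± 2h`
  have e1 := hT (ν + h) (by rw [add_sub_cancel_left, abs_of_pos hh, hh_def]; linarith)
  have e2 := hT (ν + 2 * h) (by rw [add_sub_cancel_left, abs_of_pos (by positivity), hh_def]; linarith)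
  have e3 := hT (ν - h) (by rw [sub_sub_cancel_left, abs_neg, abs_of_pos hh, hh_def]; linarith)
  have e4 := hT (ν - 2 * h) (by rw [sub_sub_cancel_left, abs_neg, abs_of_pos (by positivity), hh_def]; linarith)
  rw [add_sub_cancel_left, abs_of_pos hh] at e1
  rw [add_sub_cancel_left, abs_of_pos (by positivity : (0:ℝ) < 2 * h)] at e2
  rw [sub_sub_cancel_left, abs_neg, abs_of_pos hh] at e3
  rw [sub_sub_cancel_left, abs_neg, abs_of_pos (by positivity : (0:ℝ) < 2 * h)] at e4
  rw [abs_le] at e1 e2 e3 e4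
  have hS : f (ν + h) - f (ν + 2 * h) - f (ν - 2 * h) + f (ν - h) < ε * h := by nlinarith
  -- the finite-volume four-point combination converges to it, hence is eventually `< ε h`
  have hlim : Tendsto (fun L : ℕ =>
      (hubbardTorusWith 2 (L + 1) 1 U (ν + h)).groundEnergy / ((L + 1 : ℕ) : ℝ) ^ 2 -
      (hubbardTorusWith 2 (L + 1) 1 U (ν + 2 * h)).groundEnergy / ((L + 1 : ℕ) : ℝ) ^ 2 -
      (hubbardTorusWith 2 (L + 1) 1 U (ν - 2 * h)).groundEnergy / ((L + 1 : ℕ) : ℝ) ^ 2 +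
      (hubbardTorusWith 2 (L + 1) 1 U (ν - h)).groundEnergy / ((L + 1 : ℕ) : ℝ) ^ 2) atTop
      (𝓝 (f (ν + h) - f (ν + 2 * h) - f (ν - 2 * h) + f (ν - h))) :=
    (((wcbcs_eos_tendsto U (ν + h)).sub (wcbcs_eos_tendsto U (ν + 2 * h))).sub
      (wcbcs_eos_tendsto U (ν - 2 * h))).add (wcbcs_eos_tendsto U (ν - h))
  filter_upwards [hlim.eventually (gt_mem_nhds hS)] with L hL
  have hV : (0 : ℝ) < ((L + 1 : ℕ) : ℝ) ^ 2 := by positivity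
  -- Griffiths sandwich: `N(ν+h) ≤ (E(ν+h) - E(ν+2h))/h`, `(E(ν-2h) - E(ν-h))/h ≤ N(ν-h)`
  obtain ⟨-, h1⟩ := gcNumber_torus_mem_Icc_slope (L + 1) 1 U (ν + h) hh
  obtain ⟨h2, -⟩ := gcNumber_torus_mem_Icc_slope (L + 1) 1 U (ν - h) hh
  rw [show ν + h + h = ν + 2 * h by ring, le_div_iff₀ hh] at h1
  rw [show ν - h - h = ν - 2 * h by ring, div_le_iff₀ hh] at h2
  rw [← sub_div, div_le_iff₀ hV]
  rw [← sub_div, ← sub_div, ← add_div, div_lt_iff₀ hV] at hL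
  nlinarith

/-- **Stub (D) from its finite-volume normal form** (registered sub-goal `stub_regularEquationOfStateOfNoDensityJump`
of crux stmt-HubbardSuperconductivity-2010, line `ladder-scale-certified-chain`). IF there are a doping bracket
`0 < a < b < 1/2` and `U_D > 0` such that for every `U ∈ (0, U_D)`: (i) at every `ν` of the window `[-4/5, -7/20]` the
finite-volume densities have no jump — `∀ ε > 0 ∃ h > 0`, for infinitely many `L`, `n_L(U,ν+h) - n_L(U,ν-h) ≤ ε` — and
(ii) the end densities bracket the window in the weakest limiting sense, `liminf_L n_L(U,-4/5) ≤ 1 - b` and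
`1 - a ≤ limsup_L n_L(U,-7/20)`, THEN the registered stub `stub_regularEquationOfState` of the line holds VERBATIM
(`e' := ∂_ν e(U,·)`; differentiability by `wcbcs_eos_differentiableAt_of_noDensityJump`; at the two ends the density
converges by `wcbcs_tendsto_gcDensity_of_differentiableAt`, so its `liminf`/`limsup` is its limit `-e'`). Clause (i) at
`ν` is equivalent to differentiability of `e(U,·)` at `ν` (the converse by the Griffiths sandwich at steps `h, 2h`);
the hypothesis as a whole is the open part of (D) — no phase separation at weak coupling in the window — and nothing
here proves it. [cite: KomaTasaki1994, §1] -/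
theorem stub_regularEquationOfStateOfNoDensityJump :
    (∃ a b : ℝ, 0 < a ∧ a < b ∧ b < 1 / 2 ∧ ∃ U_D : ℝ, 0 < U_D ∧ ∀ U ∈ Set.Ioo (0:ℝ) U_D,
      (∀ ν ∈ Set.Icc (-(4:ℝ) / 5) (-(7:ℝ) / 20), ∀ ε > 0, ∃ h > 0, ∃ᶠ L : ℕ in atTop,
        ((hubbardTorusWith 2 (L + 1) 1 U (ν + h)).groundStateFunctional totalNumber).re /
            ((L + 1 : ℕ) : ℝ) ^ 2 -
          ((hubbardTorusWith 2 (L + 1) 1 U (ν - h)).groundStateFunctional totalNumber).re /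
            ((L + 1 : ℕ) : ℝ) ^ 2 ≤ ε) ∧
      liminf (fun L : ℕ => ((hubbardTorusWith 2 (L + 1) 1 U (-(4:ℝ) / 5)).groundStateFunctional
        totalNumber).re / ((L + 1 : ℕ) : ℝ) ^ 2) atTop ≤ 1 - b ∧
      1 - a ≤ limsup (fun L : ℕ => ((hubbardTorusWith 2 (L + 1) 1 U (-(7:ℝ) / 20)).groundStateFunctional
        totalNumber).re / ((L + 1 : ℕ) : ℝ) ^ 2) atTop) →
    ∃ a b : ℝ, 0 < a ∧ a < b ∧ b < 1 / 2 ∧ ∃ U_D : ℝ, 0 < U_D ∧ ∀ U ∈ Set.Ioo (0:ℝ) U_D,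
      ∃ e' : ℝ → ℝ,
        (∀ ν ∈ Set.Icc (-(4:ℝ) / 5) (-(7:ℝ) / 20),
          HasDerivAt (fun ν' : ℝ => limUnder atTop (fun L : ℕ =>
            (hubbardTorusWith 2 (L + 1) 1 U ν').groundEnergy / ((L + 1 : ℕ) : ℝ) ^ 2)) (e' ν) ν) ∧
        -e' (-(4:ℝ) / 5) ≤ 1 - b ∧ 1 - a ≤ -e' (-(7:ℝ) / 20) := by
  rintro ⟨a, b, ha, hab, hb, U_D, hUD, hfv⟩
  refine ⟨a, b, ha, hab, hb, U_D, hUD, fun U hU => ?_⟩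
  obtain ⟨hnj, h₁, h₂⟩ := hfv U hU
  have hdiff : ∀ ν ∈ Set.Icc (-(4:ℝ) / 5) (-(7:ℝ) / 20), DifferentiableAt ℝ (fun y : ℝ => limUnder atTop
      (fun L : ℕ => (hubbardTorusWith 2 (L + 1) 1 U y).groundEnergy / ((L + 1 : ℕ) : ℝ) ^ 2)) ν :=
    fun ν hν => wcbcs_eos_differentiableAt_of_noDensityJump U ν (hnj ν hν)
  have hw₁ : (-(4:ℝ) / 5) ∈ Set.Icc (-(4:ℝ) / 5) (-(7:ℝ) / 20) := ⟨le_rfl, by norm_num⟩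
  have hw₂ : (-(7:ℝ) / 20) ∈ Set.Icc (-(4:ℝ) / 5) (-(7:ℝ) / 20) := ⟨by norm_num, le_rfl⟩
  refine ⟨deriv (fun y : ℝ => limUnder atTop (fun L : ℕ => (hubbardTorusWith 2 (L + 1) 1 U y).groundEnergy /
    ((L + 1 : ℕ) : ℝ) ^ 2)), fun ν hν => (hdiff ν hν).hasDerivAt, ?_, ?_⟩
  · rwa [(wcbcs_tendsto_gcDensity_of_differentiableAt U _ (hdiff _ hw₁)).liminf_eq] at h₁
  · rwa [(wcbcs_tendsto_gcDensity_of_differentiableAt U _ (hdiff _ hw₂)).limsup_eq] at h₂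

end Summit.HubbardSuperconductivity.HubbardSuperconductivity.Theorems
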